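import Summits.BirchSwinnertonDyer.Rank1Residual.Additive.GordHigherLineMatching
import Summits.BirchSwinnertonDyer.Rank1Residual.AdditivePotMult.MixedCongruentPairGV
import Summits.BirchSwinnertonDyer.Rank1Residual.AdditivePotMult.PotMultRamifiedLineKummerEqAt
import HarnessLib

/-!
# Route G's typed input `CongruentLambdaShift` and the `μ = 0` transfer on congruent pairs with a
# (G-ord) member of ANY semistability defect — from the cited GV §2 record (A240), `p ≥ 5`, off the
# swap locus `(p − 1) ∣ lcm(e₁, e₂)`, modulo the R-D identification on the `e ∈ {3,4,6}` members
# (cell `b2b-bsdres`, team n1011, seat p07 (gen 7); row T-ROL-EXP FILE D2; R3″ on Gord_e346 links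
# 'λ-SHIFT TYPED mod hRD and A240', TRANSPORT-TEMPLATE v2.0)

HONEST FRAMING (cell `b2b-bsdres`, run/shared/lean/b2b/bsd-rank1-residual/, verbatim in every
file): the goal of the cell is to DELETE the COMBINATION-SHAPED residual classes of the
Birch–Swinnerton-Dyer formula for ALL analytic-rank `≤ 1` elliptic curves over `ℚ` — "full BSD
formula for every rank `≤ 1` curve in class `C`" assembled STRICTLY from published theorems — so
that the rank-`≤ 1` remainder becomes exactly the CONSTRUCTION-SHAPED classes, which are TYPED
(missing-input `Prop`s), NOT attempted. This is not "finishing BSD". Team n1011 (N10/N11, the (G-ord)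
rows of every defect and the (M) rows): research route; labels and marks UNCHANGED; nothing booked.
TOOL theorems only: NO definition, NO named fact. CONDITIONAL on the tree's EXISTING named facts
exactly as the consumed files: `hGV` = cc-typer-2's COMPOSED GV §2 record A240
(`GreenbergVatsal2000.muLambdaAlg_transfer_of_torsionIso_potOrd_of_not_dvd_torsionOrder`; its
`_holds` route is T-A240-PORT and T-A240-K, not this file), A239 `hGrK` (R-D on a (G-ord, `e = 2`) member),
A40/A41 `hT40`/`hT41` (R-D on an (M) member); on an `e ∈ {3,4,6}` member `RamifiedLineKummerEqAt W p`
stays an EXPLICIT binder (S2 + p05's T-RD-E346, not in the tree).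

## What and why

cc-typer-2's schema-level `congruentLambdaShift_of_gv` / `mu_eq_zero_of_gv`
(`CongruentLambdaShiftOfGVTorsionIso` §1) read Route G's typed input
`CongruentLambdaShift W₁ W₂ p (Σ_{w∈Σ₀} (δ(E₂,w) − δ(E₁,w)))` and GV p. 27's `μ` transfer off A240,
given ramified ordinary lines `L₁`, `L₂` at `v ∋ p` and ONE `Γ_ℚ`-equivariant `E₁[p] ≃+ E₂[p]`
respecting them. p07 (gen 5) discharged the line clause on the four defect-2 loci through twist
models. On a link with a member of defect `e ∈ {3,4,6}` the line clause is row T-ROL-EXP FILE C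
(`GordHigherLineMatching.inclusion_mem_iff_of_typeGOrd_typeGOrd_of_not_dvd_lcm` and its Gord × (M)
form — cc-typer-2's S3 fed with the inertia exponents), the lines are p05's F-C2 / p10's / p07's, and
the congruence is the census's `TorsionIso`. This file composes them:

* §1 Gord × Gord (any defects, `p ≥ 5`, `¬ (p−1) ∣ lcm(e₁,e₂)`):
  `congruentLambdaShift_of_gv_of_typeGOrd_typeGOrd_of_not_dvd_lcm`, `mu_eq_zero_of_gv_…` (hRD₁, hRD₂
  explicit binders);
* §2 Gord × (M) and (M) × Gord (mod A40/A41 on the (M) side; hRD explicit on the (G-ord) side).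

NOT here: budgets / ENDs on e346 receivers (Kato-direction input construction-shaped, class file N10
§5); the swap locus; `p = 3`; any discharge of `hGV` or of `hRD` on e346.

References: R. Greenberg, V. Vatsal, Invent. Math. 142 (2000) §2 Prop. (2.8), Remark (2.9), Cor. (2.3),
Prop. (2.4), pp. 26–27 [GreenbergVatsal2000]; R. Greenberg, LNM 1716 (1999) §2 Prop. 2.4
[GreenbergLNM1716]; M. Emerton, R. Pollack, T. Weston, Invent. Math. 163 (2006) pp. 2–3, §3.1
[EmertonPollackWeston2006]; cells/n1011/skel/T-ROL-EXP.md (67779f27699eb635);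
class-closure/N10/TRANSPORT-TEMPLATE.md v2.0.
-/

set_option autoImplicit false

noncomputable section

open scoped Classical NumberField

open NumberField IsDedekindDomain Field WeierstrassCurve
  Literature.NumberTheory.GaloisRepresentations
  Literature.NumberTheory.EllipticCurves
  Literature.NumberTheory.EllipticCurves.Rank1Residual
  Literature.NumberTheory.EllipticCurves.GreenbergSelmer
  Literature.NumberTheory.EllipticCurves.Greenberg1999
  Literature.NumberTheory.EllipticCurves.GreenbergVatsal2000
  Literature.NumberTheory.EllipticCurves.EmertonPollackWeston2006
  Summit.BirchSwinnertonDyer.Rank1Residual.X1.CongruenceTransfer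
open WeierstrassCurve (geomTorsion geomPrimaryTorsion geomTorsion_le_geomPrimaryTorsion)

namespace Summit.BirchSwinnertonDyer.Rank1Residual.Additive

namespace GordHigherCongruentPairGVShift

open GordHigherLineMatching

/-- The place `v_p` of `ℚ` above the prime `p` exists (`(p)` lies in a maximal ideal of `𝓞 ℚ`,
non-zero since `p ≠ 0`). Local copy of the private lemma of cc-typer-2's
`CongruentLambdaShiftOfGVTorsionIso`. [folklore] -/
theorem exists_natCast_mem_asIdeal {p : ℕ} [hp : Fact p.Prime] :
    ∃ v : HeightOneSpectrum (𝓞 ℚ), ((p : ℕ) : 𝓞 ℚ) ∈ v.asIdeal := by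
  have hnu : ¬ IsUnit ((p : ℕ) : 𝓞 ℚ) := by
    intro h
    have h' := h.map Rat.ringOfIntegersEquiv
    rw [map_natCast, Int.isUnit_iff_natAbs_eq, Int.natAbs_natCast] at h'
    exact hp.out.one_lt.ne' h'
  obtain ⟨M, hM, hle⟩ := Ideal.exists_le_maximal (Ideal.span {((p : ℕ) : 𝓞 ℚ)})
    (by rwa [Ne, Ideal.span_singleton_eq_top])
  have hpM : ((p : ℕ) : 𝓞 ℚ) ∈ M := hle (Ideal.mem_span_singleton_self _)
  refine ⟨⟨M, hM.isPrime, fun hbot ↦ ?_⟩, hpM⟩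
  rw [hbot, Ideal.mem_bot] at hpM
  exact hp.out.ne_zero (by exact_mod_cast hpM)

/-! ### §1 Gord × Gord links of any defects, off the swap locus -/

section GordGord

variable {p : ℕ} [hp : Fact p.Prime] {W₁ W₂ : WeierstrassCurve ℚ} [W₁.IsElliptic] [W₁.IsGloballyMinimal]
  [W₂.IsElliptic] [W₂.IsGloballyMinimal]

/-- **Route G's typed input on a Gord × Gord link of ANY defects, from the GV record + `TorsionIso`**
(`p ≥ 5`, `(p−1) ∤ lcm(e₁, e₂)`; `p ∤ #E_i(ℚ)_tors`; `Σ₀ ∌ p` outside which both are good; the R-D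
identifications `hRD₁`, `hRD₂` explicit — `= ramifiedLineKummerEqAt_of_typeGOrd hGrK` on an `e = 2`
member): `CongruentLambdaShift W₁ W₂ p (Σ_{w∈Σ₀} (δ(E₂,w) − δ(E₁,w)))`. Lines: FILE B
`exists_isRamifiedOrdinaryLine_and_pow_semistabilityIndex_of_typeGOrd`; line clause: FILE C
(cc-typer-2's S3). NO line binder, NO image hypothesis, NO twist model.
[cite: GreenbergVatsal2000, §2 Prop. (2.8) with Remark (2.9), Cor. (2.3), Prop. (2.4), pp. 26–27 (arXiv:math/9906215)] -/
theorem congruentLambdaShift_of_gv_of_typeGOrd_typeGOrd_of_not_dvd_lcm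
    (hGV : muLambdaAlg_transfer_of_torsionIso_potOrd_of_not_dvd_torsionOrder) (hp5 : 5 ≤ p)
    (hG₁ : TypeGOrd W₁ p) (hadd₁ : Addv W₁ p) (hG₂ : TypeGOrd W₂ p) (hadd₂ : Addv W₂ p)
    (hlcm : ¬ (p - 1) ∣ Nat.lcm (semistabilityIndex W₁ p) (semistabilityIndex W₂ p))
    (htors₁ : ¬ p ∣ W₁.torsionOrder) (htors₂ : ¬ p ∣ W₂.torsionOrder)
    (hRD₁ : RamifiedLineKummerEqAt W₁ p) (hRD₂ : RamifiedLineKummerEqAt W₂ p) (hT : TorsionIso W₁ W₂ p)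
    (S₀ : Finset (HeightOneSpectrum (𝓞 ℚ))) (hS₀ : ∀ w ∈ S₀, ((p : ℕ) : 𝓞 ℚ) ∉ w.asIdeal)
    (hS₁ : ∀ w : HeightOneSpectrum (𝓞 ℚ), w ∉ S₀ → ((p : ℕ) : 𝓞 ℚ) ∉ w.asIdeal →
      W₁.HasGoodReductionAt w)
    (hS₂ : ∀ w : HeightOneSpectrum (𝓞 ℚ), w ∉ S₀ → ((p : ℕ) : 𝓞 ℚ) ∉ w.asIdeal →
      W₂.HasGoodReductionAt w) :
    CongruentLambdaShift W₁ W₂ p (∑ w ∈ S₀, ((delta W₂ p w : ℤ) - (delta W₁ p w : ℤ))) := by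
  obtain ⟨v, hv⟩ := exists_natCast_mem_asIdeal (p := p)
  obtain ⟨L₁, hL₁, -⟩ := exists_isRamifiedOrdinaryLine_and_pow_semistabilityIndex_of_typeGOrd hp5 hG₁ hadd₁ hv
  obtain ⟨L₂, hL₂, -⟩ := exists_isRamifiedOrdinaryLine_and_pow_semistabilityIndex_of_typeGOrd hp5 hG₂ hadd₂ hv
  obtain ⟨e, he⟩ := hT
  exact congruentLambdaShift_of_gv W₁ W₂ p S₀ hGV (by omega) hv hL₁ hL₂ htors₁ htors₂ hRD₁ hRD₂
    ⟨e, he, inclusion_mem_iff_of_typeGOrd_typeGOrd_of_not_dvd_lcm hp5 hG₁ hadd₁ hG₂ hadd₂ hlcm hv hL₁ hL₂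
      e he⟩ hS₀ hS₁ hS₂

/-- **`μ(X(E₁)) = 0 ⟹ μ(X(E₂)) = 0` on a Gord × Gord link of ANY defects, from the GV record +
`TorsionIso`** (`p ≥ 5`, off the swap locus; cyclotomic data, torsion duals; hRD₁, hRD₂ explicit).
[cite: GreenbergVatsal2000, §2 Prop. (2.8) with Remark (2.9), Cor. (2.3), pp. 26–27 (arXiv:math/9906215)] -/
theorem mu_eq_zero_of_gv_of_typeGOrd_typeGOrd_of_not_dvd_lcm
    (hGV : muLambdaAlg_transfer_of_torsionIso_potOrd_of_not_dvd_torsionOrder) (hp5 : 5 ≤ p)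
    (hG₁ : TypeGOrd W₁ p) (hadd₁ : Addv W₁ p) (hG₂ : TypeGOrd W₂ p) (hadd₂ : Addv W₂ p)
    (hlcm : ¬ (p - 1) ∣ Nat.lcm (semistabilityIndex W₁ p) (semistabilityIndex W₂ p))
    (htors₁ : ¬ p ∣ W₁.torsionOrder) (htors₂ : ¬ p ∣ W₂.torsionOrder)
    (hRD₁ : RamifiedLineKummerEqAt W₁ p) (hRD₂ : RamifiedLineKummerEqAt W₂ p) (hT : TorsionIso W₁ W₂ p)
    (S₀ : Finset (HeightOneSpectrum (𝓞 ℚ))) (hS₀ : ∀ w ∈ S₀, ((p : ℕ) : 𝓞 ℚ) ∉ w.asIdeal)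
    (hS₁ : ∀ w : HeightOneSpectrum (𝓞 ℚ), w ∉ S₀ → ((p : ℕ) : 𝓞 ℚ) ∉ w.asIdeal →
      W₁.HasGoodReductionAt w)
    (hS₂ : ∀ w : HeightOneSpectrum (𝓞 ℚ), w ∉ S₀ → ((p : ℕ) : 𝓞 ℚ) ∉ w.asIdeal →
      W₂.HasGoodReductionAt w)
    {κ : ZpExtension ℚ p} {γ : absoluteGaloisGroup ℚ} (hκ : κ.IsCyclotomic)
    (hγ : κ.IsTopGenerator γ) (hγ' : IsCyclotomicVariable p γ)
    (D₁ : W₁.SelmerDualData κ γ) (D₂ : W₂.SelmerDualData κ γ)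
    [Module.Finite (IwasawaAlgebra p) D₁.X] [Module.Finite (IwasawaAlgebra p) D₂.X]
    (hX₁ : D₁.IsTorsion) (hX₂ : D₂.IsTorsion) (hμ₁ : D₁.mu = 0) : D₂.mu = 0 := by
  obtain ⟨v, hv⟩ := exists_natCast_mem_asIdeal (p := p)
  obtain ⟨L₁, hL₁, -⟩ := exists_isRamifiedOrdinaryLine_and_pow_semistabilityIndex_of_typeGOrd hp5 hG₁ hadd₁ hv
  obtain ⟨L₂, hL₂, -⟩ := exists_isRamifiedOrdinaryLine_and_pow_semistabilityIndex_of_typeGOrd hp5 hG₂ hadd₂ hv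
  obtain ⟨e, he⟩ := hT
  exact mu_eq_zero_of_gv W₁ W₂ p S₀ hGV (by omega) hv hL₁ hL₂ htors₁ htors₂ hRD₁ hRD₂
    ⟨e, he, inclusion_mem_iff_of_typeGOrd_typeGOrd_of_not_dvd_lcm hp5 hG₁ hadd₁ hG₂ hadd₂ hlcm hv hL₁ hL₂
      e he⟩ hS₀ hS₁ hS₂ hκ hγ hγ' D₁ D₂ hX₁ hX₂ hμ₁

/-- **The receiver-`e346` / partner-`e = 2` form**: partner's R-D DISCHARGED mod A239
(`ramifiedLineKummerEqAt_of_typeGOrd hGrK`), receiver's `hRD₂` explicit; side condition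
`¬ (p−1) ∣ lcm(2, e₂)`. [cite: GreenbergVatsal2000, §2 Prop. (2.8) with Remark (2.9), Cor. (2.3), Prop. (2.4), pp. 26–27 (arXiv:math/9906215)]
[cite: GreenbergLNM1716, §2 Prop. 2.4 (p. 80)] -/
theorem congruentLambdaShift_of_gv_of_gordTwoPartner_of_not_dvd_lcm
    (hGV : muLambdaAlg_transfer_of_torsionIso_potOrd_of_not_dvd_torsionOrder)
    (hGrK : imKummer_ge_strictCondition_goodOrdinary) (hp5 : 5 ≤ p)
    (hG₁ : TypeGOrd W₁ p) (hadd₁ : Addv W₁ p) (he₁ : semistabilityIndex W₁ p = 2)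
    (hG₂ : TypeGOrd W₂ p) (hadd₂ : Addv W₂ p) (hlcm : ¬ (p - 1) ∣ Nat.lcm 2 (semistabilityIndex W₂ p))
    (htors₁ : ¬ p ∣ W₁.torsionOrder) (htors₂ : ¬ p ∣ W₂.torsionOrder)
    (hRD₂ : RamifiedLineKummerEqAt W₂ p) (hT : TorsionIso W₁ W₂ p)
    (S₀ : Finset (HeightOneSpectrum (𝓞 ℚ))) (hS₀ : ∀ w ∈ S₀, ((p : ℕ) : 𝓞 ℚ) ∉ w.asIdeal)
    (hS₁ : ∀ w : HeightOneSpectrum (𝓞 ℚ), w ∉ S₀ → ((p : ℕ) : 𝓞 ℚ) ∉ w.asIdeal →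
      W₁.HasGoodReductionAt w)
    (hS₂ : ∀ w : HeightOneSpectrum (𝓞 ℚ), w ∉ S₀ → ((p : ℕ) : 𝓞 ℚ) ∉ w.asIdeal →
      W₂.HasGoodReductionAt w) :
    CongruentLambdaShift W₁ W₂ p (∑ w ∈ S₀, ((delta W₂ p w : ℤ) - (delta W₁ p w : ℤ))) :=
  congruentLambdaShift_of_gv_of_typeGOrd_typeGOrd_of_not_dvd_lcm hGV hp5 hG₁ hadd₁ hG₂ hadd₂ (by rwa [he₁])
    htors₁ htors₂ (AdditivePotMult.ramifiedLineKummerEqAt_of_typeGOrd hGrK (by omega) hG₁ hadd₁ he₁) hRD₂ hT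
    S₀ hS₀ hS₁ hS₂

end GordGord

end GordHigherCongruentPairGVShift

end Summit.BirchSwinnertonDyer.Rank1Residual.Additive

/-! ### §2 Gord × (M) and (M) × Gord links (mod A40/A41) -/

namespace Summit.BirchSwinnertonDyer.Rank1Residual.AdditivePotMult

namespace GordHigherCongruentPairGVShift

open Summit.BirchSwinnertonDyer.Rank1Residual.Additive
open Summit.BirchSwinnertonDyer.Rank1Residual.Additive.GordHigherLineMatching
open Summit.BirchSwinnertonDyer.Rank1Residual.AdditivePotMult.GordHigherLineMatching
open Summit.BirchSwinnertonDyer.Rank1Residual.Additive.GordHigherCongruentPairGVShift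
  (exists_natCast_mem_asIdeal)

variable {p : ℕ} [hp : Fact p.Prime] {W₁ W₂ : WeierstrassCurve ℚ} [W₁.IsElliptic] [W₁.IsGloballyMinimal]
  [W₂.IsElliptic] [W₂.IsGloballyMinimal]

/-- **Route G's typed input on a Gord × (M) link** (receiver `E₁` (G-ord) of any defect, partner `E₂`
potentially multiplicative; `p ≥ 5`, `¬ (p−1) ∣ lcm(e₁, 2)`; receiver's `hRD₁` explicit, partner's R-D
mod A40/A41 by `PotMult.ramifiedLineKummerEqAt`): `CongruentLambdaShift W₁ W₂ p (Σ δ₂ − Σ δ₁)` from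
the GV record + `TorsionIso`. [cite: GreenbergVatsal2000, §2 pp. 14–15, Prop. (2.8) with Remark (2.9), Cor. (2.3), Prop. (2.4), pp. 26–27 (arXiv:math/9906215)]
[cite: SilvermanATAEC1994, Ch. V Thm. 5.3, Cor. 5.4] -/
theorem congruentLambdaShift_of_gv_of_typeGOrd_potMult_of_not_dvd_lcm
    (hGV : muLambdaAlg_transfer_of_torsionIso_potOrd_of_not_dvd_torsionOrder)
    (hT40 : Silverman1994_thmV53_tateUniformisation.{0})
    (hT41 : Silverman1994_thmV53_corV54_tateUniformisation.{0}) (hp5 : 5 ≤ p)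
    (hG₁ : TypeGOrd W₁ p) (hadd₁ : Addv W₁ p) (hpm₂ : PotMult W₂ p)
    (hlcm : ¬ (p - 1) ∣ Nat.lcm (semistabilityIndex W₁ p) 2)
    (htors₁ : ¬ p ∣ W₁.torsionOrder) (htors₂ : ¬ p ∣ W₂.torsionOrder)
    (hRD₁ : RamifiedLineKummerEqAt W₁ p) (hT : TorsionIso W₁ W₂ p)
    (S₀ : Finset (HeightOneSpectrum (𝓞 ℚ))) (hS₀ : ∀ w ∈ S₀, ((p : ℕ) : 𝓞 ℚ) ∉ w.asIdeal)
    (hS₁ : ∀ w : HeightOneSpectrum (𝓞 ℚ), w ∉ S₀ → ((p : ℕ) : 𝓞 ℚ) ∉ w.asIdeal →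
      W₁.HasGoodReductionAt w)
    (hS₂ : ∀ w : HeightOneSpectrum (𝓞 ℚ), w ∉ S₀ → ((p : ℕ) : 𝓞 ℚ) ∉ w.asIdeal →
      W₂.HasGoodReductionAt w) :
    CongruentLambdaShift W₁ W₂ p (∑ w ∈ S₀, ((delta W₂ p w : ℤ) - (delta W₁ p w : ℤ))) := by
  have hp2 : p ≠ 2 := by omega
  obtain ⟨v, hv⟩ := exists_natCast_mem_asIdeal (p := p)
  obtain ⟨L₁, hL₁, -⟩ := exists_isRamifiedOrdinaryLine_and_pow_semistabilityIndex_of_typeGOrd hp5 hG₁ hadd₁ hv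
  obtain ⟨L₂, hL₂, -⟩ := hpm₂.exists_isRamifiedOrdinaryLine_and_sq hT40 hT41 hp2 hv
  obtain ⟨e, he⟩ := hT
  exact congruentLambdaShift_of_gv W₁ W₂ p S₀ hGV hp2 hv hL₁ hL₂ htors₁ htors₂ hRD₁
    (hpm₂.ramifiedLineKummerEqAt hT40 hT41 hp2)
    ⟨e, he, inclusion_mem_iff_of_typeGOrd_potMult_of_not_dvd_lcm hT40 hT41 hp5 hG₁ hadd₁ hpm₂ hlcm hv hL₁
      hL₂ e he⟩ hS₀ hS₁ hS₂

/-- **`μ = 0` transfer on a Gord × (M) link** (receiver (G-ord) of any defect, partner potentially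
multiplicative: `μ(X(E₁)) = 0 ⟹ μ(X(E₂)) = 0`; same hypotheses; cyclotomic data, torsion duals).
[cite: GreenbergVatsal2000, §2 pp. 14–15, Prop. (2.8) with Remark (2.9), Cor. (2.3), pp. 26–27 (arXiv:math/9906215)] -/
theorem mu_eq_zero_of_gv_of_typeGOrd_potMult_of_not_dvd_lcm
    (hGV : muLambdaAlg_transfer_of_torsionIso_potOrd_of_not_dvd_torsionOrder)
    (hT40 : Silverman1994_thmV53_tateUniformisation.{0})
    (hT41 : Silverman1994_thmV53_corV54_tateUniformisation.{0}) (hp5 : 5 ≤ p)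
    (hG₁ : TypeGOrd W₁ p) (hadd₁ : Addv W₁ p) (hpm₂ : PotMult W₂ p)
    (hlcm : ¬ (p - 1) ∣ Nat.lcm (semistabilityIndex W₁ p) 2)
    (htors₁ : ¬ p ∣ W₁.torsionOrder) (htors₂ : ¬ p ∣ W₂.torsionOrder)
    (hRD₁ : RamifiedLineKummerEqAt W₁ p) (hT : TorsionIso W₁ W₂ p)
    (S₀ : Finset (HeightOneSpectrum (𝓞 ℚ))) (hS₀ : ∀ w ∈ S₀, ((p : ℕ) : 𝓞 ℚ) ∉ w.asIdeal)
    (hS₁ : ∀ w : HeightOneSpectrum (𝓞 ℚ), w ∉ S₀ → ((p : ℕ) : 𝓞 ℚ) ∉ w.asIdeal →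
      W₁.HasGoodReductionAt w)
    (hS₂ : ∀ w : HeightOneSpectrum (𝓞 ℚ), w ∉ S₀ → ((p : ℕ) : 𝓞 ℚ) ∉ w.asIdeal →
      W₂.HasGoodReductionAt w)
    {κ : ZpExtension ℚ p} {γ : absoluteGaloisGroup ℚ} (hκ : κ.IsCyclotomic)
    (hγ : κ.IsTopGenerator γ) (hγ' : IsCyclotomicVariable p γ)
    (D₁ : W₁.SelmerDualData κ γ) (D₂ : W₂.SelmerDualData κ γ)
    [Module.Finite (IwasawaAlgebra p) D₁.X] [Module.Finite (IwasawaAlgebra p) D₂.X]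
    (hX₁ : D₁.IsTorsion) (hX₂ : D₂.IsTorsion) (hμ₁ : D₁.mu = 0) : D₂.mu = 0 := by
  have hp2 : p ≠ 2 := by omega
  obtain ⟨v, hv⟩ := exists_natCast_mem_asIdeal (p := p)
  obtain ⟨L₁, hL₁, -⟩ := exists_isRamifiedOrdinaryLine_and_pow_semistabilityIndex_of_typeGOrd hp5 hG₁ hadd₁ hv
  obtain ⟨L₂, hL₂, -⟩ := hpm₂.exists_isRamifiedOrdinaryLine_and_sq hT40 hT41 hp2 hv
  obtain ⟨e, he⟩ := hT
  exact mu_eq_zero_of_gv W₁ W₂ p S₀ hGV hp2 hv hL₁ hL₂ htors₁ htors₂ hRD₁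
    (hpm₂.ramifiedLineKummerEqAt hT40 hT41 hp2)
    ⟨e, he, inclusion_mem_iff_of_typeGOrd_potMult_of_not_dvd_lcm hT40 hT41 hp5 hG₁ hadd₁ hpm₂ hlcm hv hL₁
      hL₂ e he⟩ hS₀ hS₁ hS₂ hκ hγ hγ' D₁ D₂ hX₁ hX₂ hμ₁

/-- **Route G's typed input on an (M) × Gord link** (receiver `E₁` potentially multiplicative — its R-D
mod A40/A41 — partner `E₂` (G-ord) of any defect with `hRD₂` explicit; `p ≥ 5`,
`¬ (p−1) ∣ lcm(2, e₂)`): `CongruentLambdaShift W₁ W₂ p (Σ δ₂ − Σ δ₁)` from the GV record + `TorsionIso`.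
[cite: GreenbergVatsal2000, §2 pp. 14–15, Prop. (2.8) with Remark (2.9), Cor. (2.3), Prop. (2.4), pp. 26–27 (arXiv:math/9906215)]
[cite: SilvermanATAEC1994, Ch. V Thm. 5.3, Cor. 5.4] -/
theorem congruentLambdaShift_of_gv_of_potMult_typeGOrd_of_not_dvd_lcm
    (hGV : muLambdaAlg_transfer_of_torsionIso_potOrd_of_not_dvd_torsionOrder)
    (hT40 : Silverman1994_thmV53_tateUniformisation.{0})
    (hT41 : Silverman1994_thmV53_corV54_tateUniformisation.{0}) (hp5 : 5 ≤ p)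
    (hpm₁ : PotMult W₁ p) (hG₂ : TypeGOrd W₂ p) (hadd₂ : Addv W₂ p)
    (hlcm : ¬ (p - 1) ∣ Nat.lcm 2 (semistabilityIndex W₂ p))
    (htors₁ : ¬ p ∣ W₁.torsionOrder) (htors₂ : ¬ p ∣ W₂.torsionOrder)
    (hRD₂ : RamifiedLineKummerEqAt W₂ p) (hT : TorsionIso W₁ W₂ p)
    (S₀ : Finset (HeightOneSpectrum (𝓞 ℚ))) (hS₀ : ∀ w ∈ S₀, ((p : ℕ) : 𝓞 ℚ) ∉ w.asIdeal)
    (hS₁ : ∀ w : HeightOneSpectrum (𝓞 ℚ), w ∉ S₀ → ((p : ℕ) : 𝓞 ℚ) ∉ w.asIdeal →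
      W₁.HasGoodReductionAt w)
    (hS₂ : ∀ w : HeightOneSpectrum (𝓞 ℚ), w ∉ S₀ → ((p : ℕ) : 𝓞 ℚ) ∉ w.asIdeal →
      W₂.HasGoodReductionAt w) :
    CongruentLambdaShift W₁ W₂ p (∑ w ∈ S₀, ((delta W₂ p w : ℤ) - (delta W₁ p w : ℤ))) := by
  have hp2 : p ≠ 2 := by omega
  obtain ⟨v, hv⟩ := exists_natCast_mem_asIdeal (p := p)
  obtain ⟨L₁, L₂, hL₁, hL₂, hmatch⟩ :=
    exists_lines_matching_of_potMult_typeGOrd_of_not_dvd_lcm hT40 hT41 hp5 hpm₁ hG₂ hadd₂ hlcm hv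
  obtain ⟨e, he⟩ := hT
  exact congruentLambdaShift_of_gv W₁ W₂ p S₀ hGV hp2 hv hL₁ hL₂ htors₁ htors₂
    (hpm₁.ramifiedLineKummerEqAt hT40 hT41 hp2) hRD₂ ⟨e, he, hmatch e he⟩ hS₀ hS₁ hS₂

/-- **`μ = 0` transfer on an (M) × Gord link** (receiver potentially multiplicative, partner (G-ord) of
any defect: `μ(X(E₁)) = 0 ⟹ μ(X(E₂)) = 0`). [cite: GreenbergVatsal2000, §2 pp. 14–15, Prop. (2.8) with Remark (2.9), Cor. (2.3), pp. 26–27 (arXiv:math/9906215)] -/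
theorem mu_eq_zero_of_gv_of_potMult_typeGOrd_of_not_dvd_lcm
    (hGV : muLambdaAlg_transfer_of_torsionIso_potOrd_of_not_dvd_torsionOrder)
    (hT40 : Silverman1994_thmV53_tateUniformisation.{0})
    (hT41 : Silverman1994_thmV53_corV54_tateUniformisation.{0}) (hp5 : 5 ≤ p)
    (hpm₁ : PotMult W₁ p) (hG₂ : TypeGOrd W₂ p) (hadd₂ : Addv W₂ p)
    (hlcm : ¬ (p - 1) ∣ Nat.lcm 2 (semistabilityIndex W₂ p))
    (htors₁ : ¬ p ∣ W₁.torsionOrder) (htors₂ : ¬ p ∣ W₂.torsionOrder)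
    (hRD₂ : RamifiedLineKummerEqAt W₂ p) (hT : TorsionIso W₁ W₂ p)
    (S₀ : Finset (HeightOneSpectrum (𝓞 ℚ))) (hS₀ : ∀ w ∈ S₀, ((p : ℕ) : 𝓞 ℚ) ∉ w.asIdeal)
    (hS₁ : ∀ w : HeightOneSpectrum (𝓞 ℚ), w ∉ S₀ → ((p : ℕ) : 𝓞 ℚ) ∉ w.asIdeal →
      W₁.HasGoodReductionAt w)
    (hS₂ : ∀ w : HeightOneSpectrum (𝓞 ℚ), w ∉ S₀ → ((p : ℕ) : 𝓞 ℚ) ∉ w.asIdeal →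
      W₂.HasGoodReductionAt w)
    {κ : ZpExtension ℚ p} {γ : absoluteGaloisGroup ℚ} (hκ : κ.IsCyclotomic)
    (hγ : κ.IsTopGenerator γ) (hγ' : IsCyclotomicVariable p γ)
    (D₁ : W₁.SelmerDualData κ γ) (D₂ : W₂.SelmerDualData κ γ)
    [Module.Finite (IwasawaAlgebra p) D₁.X] [Module.Finite (IwasawaAlgebra p) D₂.X]
    (hX₁ : D₁.IsTorsion) (hX₂ : D₂.IsTorsion) (hμ₁ : D₁.mu = 0) : D₂.mu = 0 := by
  have hp2 : p ≠ 2 := by omega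
  obtain ⟨v, hv⟩ := exists_natCast_mem_asIdeal (p := p)
  obtain ⟨L₁, L₂, hL₁, hL₂, hmatch⟩ :=
    exists_lines_matching_of_potMult_typeGOrd_of_not_dvd_lcm hT40 hT41 hp5 hpm₁ hG₂ hadd₂ hlcm hv
  obtain ⟨e, he⟩ := hT
  exact mu_eq_zero_of_gv W₁ W₂ p S₀ hGV hp2 hv hL₁ hL₂ htors₁ htors₂
    (hpm₁.ramifiedLineKummerEqAt hT40 hT41 hp2) hRD₂ ⟨e, he, hmatch e he⟩ hS₀ hS₁ hS₂ hκ hγ hγ' D₁ D₂ hX₁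
    hX₂ hμ₁

end GordHigherCongruentPairGVShift

end Summit.BirchSwinnertonDyer.Rank1Residual.AdditivePotMult

end
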